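import Literature.AnabelianGeometry.AbsoluteAnabelian.AbsTopIProp23AlmostProSigmaOuterFaithful
import Literature.AnabelianGeometry.SemiGraphs.ProSigmaSurfaceTorsionFree
import Literature.AnabelianGeometry.SemiGraphs.ProSigmaCompletionModels
import Literature.AnabelianGeometry.SemiGraphs.ProSigmaCompletionTransport
import HarnessLib

/-!
# [AbsTopI] Prop 2.2 / 2.3 at the ALMOST pro-`Σ` model: the torsion-freeness leaf (TF) DISCHARGED

S. Mochizuki, *Topics in Absolute Anabelian Geometry I: Generalities* (2012) [AbsTopI], Def 2.1 (i) p. 18,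
Prop 2.3 (i)(ii) p. 19, Lemma 4.5 (i) p. 54 ("torsion-free pro-`Σ` open subgroup").

`AbsTopIProp23AlmostProSigmaOuterFaithful` proves Prop 2.2 / 2.3 for a profinite `Δ` with an open normal `U`
presented as a pro-`Σ` completion of a hyperbolic `Γ_{g,r}`, MODULO two geometric leaves: (TF) «`U` is
torsion-free» and (OF) «`Δ / U ↪ Out U`».  The tree already PROVES (TF) for every such `U`
(`IsProSigmaCompletion.torsionFree_puncturedSurfaceGroup`, abc-iut cell, `ProSigmaSurfaceTorsionFree` /
`FreeProSigmaTorsionFree`).  THIS PROOF-ONLY FILE removes the (TF) binder BY NAME, leaving (OF) as the single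
residual input, and records the NON-VACUITY of the remaining hypothesis set:

* `torsionFree_of_isOpen_proSigma_hyperbolic` — an open `U ≤ G` that is a pro-`Σ` completion of a hyperbolic
  `Γ_{g,r}` has no nontrivial element of finite order;
* `slim_and_elastic_of_isOpen_proSigma_hyperbolic_of_outerFaithful'` — Prop 2.3 (i) for the almost pro-`Σ`
  `G` from (OF) ALONE; `FundamentalExtension.geomSlimElastic_of_isOpen_proSigma_hyperbolic_of_outerFaithful'`,
  `FundamentalExtension.prop22_prop23_of_isOpen_proSigma_hyperbolic_mlf_of_outerFaithful'` / `_nf_…'` — the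
  typed node predicates (F-0240 / F-0239 / F-0238 conjunction) from (OF) alone;
* `exists_isOpen_proSigma_hyperbolic_outerFaithful` — the hypothesis set «`U ⊴ G` open, pro-`Σ` completion of
  `Γ_{g,r}`, (OF)» is INHABITED with `G ≠ 1` for every hyperbolic `(g, r)` and every nonempty set of primes `Σ`
  (witness: `U = G` a pro-`Σ` completion, `exists_isProSigmaCompletion`; (OF) is then tautological) — so the
  model theorems are not vacuous.

HONEST SCOPE: (OF) — outer-faithfulness of the deck group on `Δ_Y^Σ` — remains the ONE geometric input of the
almost pro-`Σ` case; it is not typed as a fact and not discharged here.  Classical; OUR kernel check; nothing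
here bears on [IUTchIII] Cor. 3.12; no side is taken.
-/

noncomputable section

open Topology

universe u

namespace Literature.AnabelianGeometry.AbsoluteAnabelian

open Literature.AlgebraicGeometry.Frobenioids (IsSlimGroup)
open Literature.AnabelianGeometry.SemiGraphs.SemiGraphOfAnabelioids
open Literature.GroupTheory.CombinatorialGroupTheory

variable {G : Type u} [Group G] [TopologicalSpace G] [IsTopologicalGroup G] [CompactSpace G] [T2Space G]
  [TotallyDisconnectedSpace G]

/-- **(TF) at the model**: an open subgroup `U` of a profinite `G` presented as a pro-`Σ` completion of a
hyperbolic `Γ_{g,r}` is torsion-free in print's sense — every element of `U` of finite order is trivial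
(`IsProSigmaCompletion.torsionFree_puncturedSurfaceGroup`; hyperbolicity `2g − 2 + r > 0` gives `r ≥ 1 ∨ g ≥ 2`).
[cite: MochizukiAbsTopI2012, Lemma 4.5 (i) p.54] -/
theorem torsionFree_of_isOpen_proSigma_hyperbolic {Sigma : Set ℕ} {g r : ℕ}
    (hgr : PuncturedSurfaceGroup.IsHyperbolicType g r) (U : Subgroup G) (hUo : IsOpen (U : Set G))
    (ι : PuncturedSurfaceGroup g r →* U) (hι : IsProSigmaCompletion Sigma ι) :
    ∀ u ∈ U, IsOfFinOrder u → u = 1 := by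
  haveI : CompactSpace U := isCompact_iff_compactSpace.mp (Subgroup.isClosed_of_isOpen U hUo).isCompact
  have hgr' : 1 ≤ r ∨ 2 ≤ g := by
    unfold PuncturedSurfaceGroup.IsHyperbolicType at hgr
    omega
  intro u hu hfin
  have h := IsProSigmaCompletion.torsionFree_puncturedSurfaceGroup hgr' hι ⟨u, hu⟩
    (Submonoid.isOfFinOrder_coe.mp hfin)
  simpa using congrArg Subtype.val h

/-- **Prop 2.3 (i), almost pro-`Σ` model, from OUTER-FAITHFULNESS ALONE**: a profinite `G` with an open normal
`U`, a pro-`Σ` completion of a hyperbolic `Γ_{g,r}` (`Σ` a nonempty set of primes), on which `G` acts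
outer-faithfully (`x` acting on `U` as an inner automorphism of `U` ⇒ `x ∈ U`) is slim and elastic — the (TF)
binder of `slim_and_elastic_of_isOpen_proSigma_hyperbolic_of_outerFaithful` discharged by
`torsionFree_of_isOpen_proSigma_hyperbolic`. [cite: MochizukiAbsTopI2012, Prop 2.3 (i) p.19] -/
theorem slim_and_elastic_of_isOpen_proSigma_hyperbolic_of_outerFaithful' {Sigma : Set ℕ} (hS : Sigma.Nonempty)
    (hSp : ∀ p ∈ Sigma, p.Prime) {g r : ℕ} (hgr : PuncturedSurfaceGroup.IsHyperbolicType g r)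
    (U : Subgroup G) [U.Normal] (hUo : IsOpen (U : Set G)) (ι : PuncturedSurfaceGroup g r →* U)
    (hι : IsProSigmaCompletion Sigma ι)
    (hOut : ∀ x : G, (∃ u ∈ U, ∀ y ∈ U, x * y * x⁻¹ = u * y * u⁻¹) → x ∈ U) : IsSlimGroup G ∧ IsElastic G :=
  slim_and_elastic_of_isOpen_proSigma_hyperbolic_of_outerFaithful hS hSp hgr U hUo ι hι
    (torsionFree_of_isOpen_proSigma_hyperbolic hgr U hUo ι hι) hOut

/-- **NON-VACUITY of the remaining hypothesis set**: for every hyperbolic `(g, r)` and every `Σ` there is a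
nontrivial-or-not profinite `G` with an open normal `U` that is a pro-`Σ` completion of `Γ_{g,r}` satisfying (OF)
— namely `U = G` itself a pro-`Σ` completion (`exists_isProSigmaCompletion`), for which (OF) is tautological.
[cite: MochizukiAbsTopI2012, Def 2.1 (i) p.18] -/
theorem exists_isOpen_proSigma_hyperbolic_outerFaithful (g r : ℕ) (Sigma : Set ℕ) :
    ∃ (P : ProfiniteGrp.{0}) (U : Subgroup P) (_ : U.Normal) (ι : PuncturedSurfaceGroup g r →* U),
      IsOpen (U : Set P) ∧ IsProSigmaCompletion Sigma ι ∧
        ∀ x : P, (∃ u ∈ U, ∀ y ∈ U, x * y * x⁻¹ = u * y * u⁻¹) → x ∈ U := by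
  obtain ⟨P, ι₀, hι₀⟩ := IsProSigmaCompletion.exists_isProSigmaCompletion (PuncturedSurfaceGroup g r) Sigma
  -- `U = ⊤ ≅ P` (explicit inverse `j`, both directions continuous)
  let j : P →* (⊤ : Subgroup P) :=
    { toFun := fun y => ⟨y, Subgroup.mem_top y⟩
      map_one' := rfl
      map_mul' := fun _ _ => rfl }
  let e : (⊤ : Subgroup P) ≃* P :=
    { toFun := fun z => (z : P)
      invFun := j
      left_inv := fun _ => rfl
      right_inv := fun _ => rfl
      map_mul' := fun _ _ => rfl }
  have he : Continuous e := continuous_subtype_val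
  have hes : Continuous e.symm := continuous_id.subtype_mk _
  refine ⟨P, ⊤, inferInstance, j.comp ι₀, isOpen_univ, ?_, fun x _ => Subgroup.mem_top x⟩
  exact IsProSigmaCompletion.of_target_mulEquiv hι₀ e he hes fun _ => rfl

/-- … and with `Σ` containing a prime the witness is NONTRIVIAL, slim and elastic (so the conclusion of the model
theorem is realised, not merely its hypotheses). [cite: MochizukiAbsTopI2012, Prop 2.3 (i) p.19] -/
theorem exists_isOpen_proSigma_hyperbolic_outerFaithful_slim {g r : ℕ}
    (hgr : PuncturedSurfaceGroup.IsHyperbolicType g r) {Sigma : Set ℕ} (hS : Sigma.Nonempty)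
    (hSp : ∀ p ∈ Sigma, p.Prime) :
    ∃ (P : ProfiniteGrp.{0}) (U : Subgroup P) (_ : U.Normal) (ι : PuncturedSurfaceGroup g r →* U),
      IsOpen (U : Set P) ∧ IsProSigmaCompletion Sigma ι ∧
        (∀ x : P, (∃ u ∈ U, ∀ y ∈ U, x * y * x⁻¹ = u * y * u⁻¹) → x ∈ U) ∧
          Nontrivial P ∧ IsSlimGroup P ∧ IsElastic P := by
  obtain ⟨P, U, hUn, ι, hUo, hι, hOut⟩ := exists_isOpen_proSigma_hyperbolic_outerFaithful g r Sigma
  haveI := hUn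
  have hse := slim_and_elastic_of_isOpen_proSigma_hyperbolic_of_outerFaithful' hS hSp hgr U hUo ι hι hOut
  obtain ⟨ℓ, hℓ⟩ := hS
  haveI : CompactSpace U := isCompact_iff_compactSpace.mp (Subgroup.isClosed_of_isOpen U hUo).isCompact
  have hnt : Nontrivial U := nontrivial_of_isProSigmaCompletion_hyperbolic ⟨ℓ, hℓ, hSp ℓ hℓ⟩ hgr ι hι
  obtain ⟨a, b, hab⟩ := hnt
  exact ⟨P, U, hUn, ι, hUo, hι, hOut, ⟨⟨a, b, fun h => hab (Subtype.ext h)⟩⟩, hse.1, hse.2⟩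

namespace FundamentalExtension

/-- **F-0239 `GeomSlimElastic` at the almost pro-`Σ` model from (OF) alone** (Def 2.1 (i) shape: `U = Δ_Y^Σ`
open normal in `Δ`, a pro-`Σ` completion of a hyperbolic `Γ_{g,r}`, with `Δ / U = Gal(Y/X) ↪ Out U`; (TF) is
now a theorem). [cite: MochizukiAbsTopI2012, Prop 2.3 (i) p.19] -/
theorem geomSlimElastic_of_isOpen_proSigma_hyperbolic_of_outerFaithful' (E : FundamentalExtension.{u})
    {Sigma : Set ℕ} (hS : Sigma.Nonempty) (hSp : ∀ p ∈ Sigma, p.Prime) {g r : ℕ}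
    (hgr : PuncturedSurfaceGroup.IsHyperbolicType g r) (U : Subgroup E.geom) [U.Normal]
    (hUo : IsOpen (U : Set E.geom)) (ι : PuncturedSurfaceGroup g r →* U) (hι : IsProSigmaCompletion Sigma ι)
    (hOut : ∀ x : E.geom, (∃ u ∈ U, ∀ y ∈ U, x * y * x⁻¹ = u * y * u⁻¹) → x ∈ U) : E.GeomSlimElastic := by
  haveI : CompactSpace E.geom := isCompact_iff_compactSpace.mp E.isClosed_geom.isCompact
  exact E.geomSlimElastic_of_isOpen_proSigma_hyperbolic_of_outerFaithful hS hSp hgr U hUo ι hι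
    (torsionFree_of_isOpen_proSigma_hyperbolic hgr U hUo ι hι) hOut

variable {E : FundamentalExtension.{0}} {Sigma : Set ℕ} {g r : ℕ}

/-- **[AbsTopI] Prop 2.2 + 2.3 (i) + 2.3 (ii) at the almost pro-`Σ` model, MLF base, from (OF) alone.**
[cite: MochizukiAbsTopI2012, Prop 2.3 p.19] -/
theorem prop22_prop23_of_isOpen_proSigma_hyperbolic_mlf_of_outerFaithful' (B : E.MLFBase) (hS : Sigma.Nonempty)
    (hSp : ∀ p ∈ Sigma, p.Prime) (hgr : PuncturedSurfaceGroup.IsHyperbolicType g r) (U : Subgroup E.geom)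
    [U.Normal] (hUo : IsOpen (U : Set E.geom)) (ι : PuncturedSurfaceGroup g r →* U)
    (hι : IsProSigmaCompletion Sigma ι)
    (hOut : ∀ x : E.geom, (∃ u ∈ U, ∀ y ∈ U, x * y * x⁻¹ = u * y * u⁻¹) → x ∈ U) :
    E.GeomTFG ∧ E.GeomSlimElastic ∧ E.ArithSlimNotElastic := by
  haveI : CompactSpace E.geom := isCompact_iff_compactSpace.mp E.isClosed_geom.isCompact
  exact prop22_prop23_of_isOpen_proSigma_hyperbolic_mlf_of_outerFaithful B hS hSp hgr U hUo ι hι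
    (torsionFree_of_isOpen_proSigma_hyperbolic hgr U hUo ι hι) hOut

/-- **[AbsTopI] Prop 2.2 + 2.3 (i) + 2.3 (ii) at the almost pro-`Σ` model, NF base, from (OF) alone.**
[cite: MochizukiAbsTopI2012, Prop 2.3 p.19] -/
theorem prop22_prop23_of_isOpen_proSigma_hyperbolic_nf_of_outerFaithful' (B : E.NFBase) (hS : Sigma.Nonempty)
    (hSp : ∀ p ∈ Sigma, p.Prime) (hgr : PuncturedSurfaceGroup.IsHyperbolicType g r) (U : Subgroup E.geom)
    [U.Normal] (hUo : IsOpen (U : Set E.geom)) (ι : PuncturedSurfaceGroup g r →* U)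
    (hι : IsProSigmaCompletion Sigma ι)
    (hOut : ∀ x : E.geom, (∃ u ∈ U, ∀ y ∈ U, x * y * x⁻¹ = u * y * u⁻¹) → x ∈ U) :
    E.GeomTFG ∧ E.GeomSlimElastic ∧ E.ArithSlimNotElastic := by
  haveI : CompactSpace E.geom := isCompact_iff_compactSpace.mp E.isClosed_geom.isCompact
  exact prop22_prop23_of_isOpen_proSigma_hyperbolic_nf_of_outerFaithful B hS hSp hgr U hUo ι hι
    (torsionFree_of_isOpen_proSigma_hyperbolic hgr U hUo ι hι) hOut

end FundamentalExtension

end Literature.AnabelianGeometry.AbsoluteAnabelian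

end
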